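import Summits.CriticalPhenomena.PercolationContinuityZ3.Theorems.PercNonProliferationFreeBoxSparseStubCollarWindow
import HarnessLib

/-!
# Crux `PercNonProliferation.FreeBoxSparse` (stmt-CriticalPhenomena-4445), line `ccfs-window-kissing-walls` —
# helper for stub `stub_collar`, part 4: the one-sided CCFS window for block sprinkling under `P_p`

Helper file for the lead's skeleton of line `ccfs-window-kissing-walls`
(prover-line-stmt-CriticalPhenomena-4445-0); lands with `--supports stmt-CriticalPhenomena-4445`.

`stub_collar_bridge` (registered, abstract in the event `E` and the blocks `U k`, `k ∈ I`): for an
event `E` determined by the pairs inside `Λ`, pairwise disjoint blocks `U k` of lattice edges of `Λ`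
with `|U k| ≤ u` and `|I| ≤ |Λ|`, and every sprinkling density `s`,
`P_p(E) ≤ Σ_{J⊆I} s^{|J|}(1−s)^{|I|−|J|} Σ_{κ⊆K} p^{|κ|}(1−p)^{|K|−|κ|} 1_E(κ ∪ U_J) + √((1 + s²p^{−u})^{|Λ|} − 1)`
(`K` = lattice edges inside `Λ`): the bridge `StubCollar.real_eq_sum_powerset` from `P_p` to the
finite product law, the abstract `χ²`/TV window `StubCollar.tv_window`, and
`∏_{k∈I}(1 + s²(p^{−|U k|} − 1)) ≤ (1 + s²p^{−u})^{|Λ|}` (`StubCollar.prod_chiSq_le`).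
-/

noncomputable section

namespace Summit.CriticalPhenomena.PercolationContinuityZ3.Theorems.FreeBoxSparse

open MeasureTheory
open Literature.Probability.Percolation Literature.Probability.LatticeModels
open scoped Classical

/-- **Registered: the one-sided CCFS window for block sprinkling under `P_p`** (abstract in the event
and the blocks). For `E` determined by the pairs inside `Λ`, pairwise disjoint blocks `U k ⊆ K`
(`K` = lattice edges inside `Λ`, `k ∈ I`, `|U k| ≤ u`, `|I| ≤ |Λ|`) and any density `s`:
`P_p(E) ≤ E_{sprinkled(s)}[1_E] + √((1 + s² p^{−u})^{|Λ|} − 1)`.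
[cite: ChayesEtAl1986, finite-size scaling window] -/
theorem stub_collar_bridge : ∀ (p : unitInterval), 0 < (p : ℝ) → ∀ (Λ : Finset (Site 3)) (E : Set (BondConfig (Site 3))), DeterminedBy E (↑Λ.sym2 : Set (Sym2 (Site 3))) → ∀ (I : Finset (Site 3)) (U : Site 3 → Finset (Sym2 (Site 3))), (↑I : Set (Site 3)).PairwiseDisjoint U → (∀ k ∈ I, U k ⊆ Λ.sym2.filter fun e => e ∈ (zdGraph 3).edgeSet) → ∀ (u : ℕ), (∀ k ∈ I, (U k).card ≤ u) → I.card ≤ Λ.card → ∀ (s : ℝ), (bondPercolation (zdGraph 3) p).real E ≤ (∑ J ∈ I.powerset, s ^ J.card * (1 - s) ^ (I.card - J.card) * ∑ κ ∈ (Λ.sym2.filter fun e => e ∈ (zdGraph 3).edgeSet).powerset, (p : ℝ) ^ κ.card * (1 - p) ^ ((Λ.sym2.filter fun e => e ∈ (zdGraph 3).edgeSet).card - κ.card) * Set.indicator E (fun _ => (1 : ℝ)) (↑(κ ∪ J.biUnion U) : Set (Sym2 (Site 3)))) + Real.sqrt ((1 + s ^ 2 * ((p : ℝ) ^ u)⁻¹)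 ^ Λ.card - 1) := by
  intro p hp0 Λ E hE I U hU hUK u hcard hI s
  have hp1 : (p : ℝ) ≤ 1 := p.2.2
  have hP := StubCollar.real_eq_sum_powerset (zdGraph 3) p Λ hE
  have htv := StubCollar.tv_window (Λ.sym2.filter fun e => e ∈ (zdGraph 3).edgeSet) I U hU hUK
    (p : ℝ) hp0 hp1 s (fun κ => Set.indicator E (fun _ => (1 : ℝ)) (↑κ : Set (Sym2 (Site 3))))
    (fun κ => by
      by_cases h : (↑κ : Set (Sym2 (Site 3))) ∈ E
      · rw [Set.indicator_of_mem h]; simp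
      · rw [Set.indicator_of_notMem h]; simp)
  have hprod := StubCollar.prod_chiSq_le I (fun k => (U k).card) (p : ℝ) s hp0 hp1 u Λ.card hcard hI
  have hsqrt := Real.sqrt_le_sqrt (sub_le_sub_right hprod 1)
  have h1 := (abs_sub_le_iff.1 htv).1
  rw [hP]
  linarith

end Summit.CriticalPhenomena.PercolationContinuityZ3.Theorems.FreeBoxSparse
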